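import Summits.QuantumFields.BalabanUV.T4Continuum.Support.OutputRateOpGaussianParamMargin
import Mathlib.MeasureTheory.Constructions.Pi
import Mathlib.MeasureTheory.Measure.Lebesgue.Basic
import Mathlib.Analysis.SpecialFunctions.Complex.Circle
import Mathlib.Analysis.Complex.RemovableSingularity

/-!
# B13TermContours — row O1-d2-ii «act instance» of the NE5 crux O1, part 3: THE CONCRETE CONTOUR-PARAMETER SPACES of
# [Balaban1988RG2Cluster] (2.14) p. 15 — per variable `dt ⊗ dθ` on `[0,1] × [0,2π]` with the Cauchy weight on the circle of radius
# `r > 1`, finitely many variables by product; finiteness, measurability, the weight letter `w₀ = Π (2π)⁻¹ r (r − 1)⁻²`, the contour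
# values on the circles and the clamped interpolation values (cell `pub-balaban`, T⁴ fan-out,
# `HOME/t4/b2b-balaban-t4-ne5-p1/O1-CLAIM-TABLE-NE5-P1.md` row O1-d2-ii; design v0.5 R18 (a) «parameter space β k i = leaf-08's PΛ»)

Unit `b2b-balaban-t4-ne5-formalise-leaf-08` (NE5 formalisation swarm, leaf prover 08, gen 2).  Summits-side NEW WORK under the LEAN
PLACEMENT RULE (cell modelling + bookkeeping; nothing of the manuscripts under audit is asserted; 0 cite tags).  HONEST FRAMING: rung
(B)+1 of the FINITE-VOLUME T⁴ continuum programme — NOT infinite volume, NOT a mass gap, NOT the Clay problem, NOT a proof of NE5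
(`T4OutputRate.NE5` is NOT PRINTED and NOT PROVED; spine 0/9, unchanged).  HONEST DEPENDENCY (cell line, verbatim): continuum YM on T⁴ ⇐
BetaPertH ∧ nine spine estimates (0/9 proved); BetaPertH ⇐ (D1) ∧ (D4) ∧ CAP+tail; G-an2-4 gates asym, D1 and NE2/3/4.

WHAT THIS MODULE IS.  In (2.14) every cube `Δ ⊂ Z∖Z′₀` carries `∫₀¹ ds(Δ) (2πi)⁻¹∮ dσ(Δ)∕(σ(Δ) − s(Δ))²` over the circle
`|σ(Δ)| = e^{κ₁}` and every polymer `Y ∈ 𝐃` carries `∫₀¹ dt(Y) (2πi)⁻¹∮ dτ(Y)∕(τ(Y) − t(Y))²` over the circle of the (2.18) radius; the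
owner's shape of record (`TermGaussianParamBi`, R18) wants this as ONE finite measure `lam` on a parameter space with a measurable weight
`w`, `‖w‖ ≤ w₀` EVERYWHERE.  Here, concretely and kernel-checked:
* §1 ONE VARIABLE: parameter `(t, θ) ∈ ℝ × ℝ` with `lam₁ := dt|_{[0,1]} ⊗ dθ|_{[0,2π]}` (FINITE); the circle point `circ r θ = r·e^{iθ}`
  (`‖circ r θ‖ = r`); the interpolation value `interp t` = `t` clamped to `[0, 1]` (so that the weight bound holds at EVERY parameter, as
  the shape demands, not only `lam₁`-a.e.); the weight `w₁ r (t, θ) := (2πi)⁻¹·((circ r θ − interp t)²)⁻¹·(i·circ r θ)` (the last factor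
  is `dτ∕dθ`); `measurable_w₁`; **`norm_w₁_le`**: `‖w₁ r p‖ ≤ wB₁ r := (2π)⁻¹((r − 1)²)⁻¹·r` for `1 < r` (the owner's
  `norm_cauchyWeight_le`).
* §2 FINITELY MANY VARIABLES `J`: `lamJ J := ⨂_{j∈J} lam₁` (FINITE), `wJ r p := Π_j w₁ (r j) (p j)` (`measurable_wJ`,
  **`norm_wJ_le`**: `‖wJ r p‖ ≤ wBJ r := Π_j wB₁ (r j)` when every `r j > 1`), the contour values `sigmaJ r p j := circ (r j) (p j).2`
  (`‖sigmaJ r p j‖ = r j` — what feeds `BiCore.τ`∕the σ-configuration of the slot) and interpolation values `sJ p j := interp (p j).1 ∈ [0, 1]`,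
  all measurable.
* §3 THE (2.14) INDEX: `J := cubes ⊕ polymers` with radii `radii κ₁ r := Sum.elim (fun _ ↦ e^{κ₁}) r`; `one_lt_radii`: all radii exceed
  `1` iff `0 < κ₁` and every (2.18) radius `r Y > 1` — the printed regime in which the Cauchy weights are bounded (the letters `κ₁`,
  `r Y` are the instancer's; KIND locators (1.22)∕(2.18), values not asserted).
* §4 `setIntegral_w₁_mul_eq_deriv` — A CHECK OF THE DICTIONARY: for `F` holomorphic near the closed disc of radius `r > 1` and
  `t ∈ [0, 1]`, `∫_{θ∈[0,2π]} w₁ r (t, θ)·F(circ r θ) dθ = F′(t)` (Cauchy's formula for the derivative, Mathlib) — the one-variable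
  weight IS the printed `(2πi)⁻¹∮ dτ∕(τ − t)²`; `integral_w₁_mul_eq_sub`: `∫ w₁ r p·F(circ r p.2) dlam₁ = F(1) − F(0)` (Fubini + FTC) —
  `(lam₁, w₁)` encode EXACTLY the first-order interpolation remainder in Cauchy form that (2.14) applies per cube and per polymer.

STATUS (census, Edison rule).  Dictionary∕bookkeeping: the letter `w₀` of R18 (b) is now a THEOREM of the concrete parameter space
(given radii > 1), and `(lam₁, w₁)` are CHECKED to reproduce `F(1) − F(0)` for holomorphic `F` (§4; the MEANING of (2.14)'s contour
representation — not needed by the shape of record, which only uses finiteness and the weight bound).  Not here: the Gaussian data, any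
estimate of [II].  NE5 NOT PROVED; 0/12 leaves on Bałaban's concrete objects; spine 0/9; rung (B)+1 finite T⁴; NOT infinite volume ∕ mass gap ∕ Clay.  0 sorry;
axioms ⊆ {propext, Classical.choice, Quot.sound}.
-/

noncomputable section

open scoped BigOperators
open Set MeasureTheory Finset

namespace Summit.QuantumFields.BalabanUV.T4Continuum.B13TermContours

open Summit.QuantumFields.BalabanUV.T4Continuum.OutputRateOpGaussianParamMargin (norm_cauchyWeight_le norm_prod_le_prod_of_le)

/-! ## §1 One contour variable: `dt ⊗ dθ` on `[0,1] × [0,2π]`, the circle point, the clamped interpolation, the Cauchy weight -/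

/-- The interpolation parameter clamped to `[0, 1]`. [folklore] -/
def interp (t : ℝ) : ℝ := max 0 (min 1 t)

/-- [folklore] `0 ≤ interp t`. -/
theorem interp_nonneg (t : ℝ) : 0 ≤ interp t := le_max_left _ _

/-- [folklore] `interp t ≤ 1`. -/
theorem interp_le_one (t : ℝ) : interp t ≤ 1 := max_le zero_le_one (min_le_left _ _)

/-- [folklore] On `[0, 1]` the clamp is the identity. -/
theorem interp_eq_self {t : ℝ} (h0 : 0 ≤ t) (h1 : t ≤ 1) : interp t = t := by
  unfold interp
  rw [min_eq_right h1, max_eq_right h0]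

/-- [folklore] The clamp is measurable. -/
theorem measurable_interp : Measurable interp := measurable_const.max (measurable_const.min measurable_id)

/-- The point of the circle of radius `r` at angle `θ`: `r·e^{iθ}`. [folklore] -/
def circ (r θ : ℝ) : ℂ := (r : ℂ) * Complex.exp ((θ : ℂ) * Complex.I)

/-- [folklore] `‖circ r θ‖ = r` for `0 ≤ r`. -/
theorem norm_circ {r : ℝ} (hr : 0 ≤ r) (θ : ℝ) : ‖circ r θ‖ = r := by
  rw [circ, norm_mul, Complex.norm_exp_ofReal_mul_I, mul_one, Complex.norm_real, Real.norm_of_nonneg hr]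

/-- [folklore] `θ ↦ circ r θ` is measurable. -/
theorem measurable_circ (r : ℝ) : Measurable (circ r) := by
  unfold circ
  exact measurable_const.mul (Complex.measurable_exp.comp (Complex.measurable_ofReal.mul_const _))

/-- THE ONE-VARIABLE PARAMETER MEASURE `dt|_{[0,1]} ⊗ dθ|_{[0,2π]}` on `ℝ × ℝ`. [folklore] -/
def lam₁ : Measure (ℝ × ℝ) := (volume.restrict (Icc (0 : ℝ) 1)).prod (volume.restrict (Icc (0 : ℝ) (2 * Real.pi)))

/-- [folklore] It is finite. -/
instance isFiniteMeasure_lam₁ : IsFiniteMeasure lam₁ := by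
  haveI h1 : IsFiniteMeasure ((volume : Measure ℝ).restrict (Icc (0 : ℝ) 1)) :=
    isFiniteMeasure_restrict.2 measure_Icc_lt_top.ne
  haveI h2 : IsFiniteMeasure ((volume : Measure ℝ).restrict (Icc (0 : ℝ) (2 * Real.pi))) :=
    isFiniteMeasure_restrict.2 measure_Icc_lt_top.ne
  unfold lam₁
  infer_instance

/-- THE CAUCHY WEIGHT OF ONE VARIABLE on the circle of radius `r`: `(2πi)⁻¹·((τ − t)²)⁻¹·(iτ)` at `τ = circ r θ`, `t = interp t`
(the factor `iτ = dτ∕dθ` converts `dτ` to `dθ`). [folklore] -/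
def w₁ (r : ℝ) (p : ℝ × ℝ) : ℂ :=
  (2 * Real.pi * Complex.I)⁻¹ * ((circ r p.2 - (interp p.1 : ℂ)) ^ 2)⁻¹ * (Complex.I * circ r p.2)

/-- [folklore] The weight is measurable. -/
theorem measurable_w₁ (r : ℝ) : Measurable (w₁ r) := by
  unfold w₁
  have hc : Measurable fun p : ℝ × ℝ => circ r p.2 := (measurable_circ r).comp measurable_snd
  have hi : Measurable fun p : ℝ × ℝ => ((interp p.1 : ℝ) : ℂ) :=
    Complex.measurable_ofReal.comp (measurable_interp.comp measurable_fst)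
  exact (measurable_const.mul ((hc.sub hi).pow_const 2).inv).mul (measurable_const.mul hc)

/-- THE WEIGHT LETTER of one variable: `wB₁ r := (2π)⁻¹·((r − 1)²)⁻¹·r`. [folklore] -/
def wB₁ (r : ℝ) : ℝ := (2 * Real.pi)⁻¹ * ((r - 1) ^ 2)⁻¹ * r

/-- [folklore] `0 ≤ wB₁ r` for `0 ≤ r`. -/
theorem wB₁_nonneg {r : ℝ} (hr : 0 ≤ r) : 0 ≤ wB₁ r := by
  unfold wB₁; positivity

/-- [folklore] **THE CAUCHY WEIGHT IS BOUNDED AT EVERY PARAMETER** for radii `r > 1` (contour outside the unit disc, interpolation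
inside): `‖w₁ r p‖ ≤ wB₁ r` (the owner's `norm_cauchyWeight_le` times `‖iτ‖ = r`). -/
theorem norm_w₁_le {r : ℝ} (hr : 1 < r) (p : ℝ × ℝ) : ‖w₁ r p‖ ≤ wB₁ r := by
  have hr0 : 0 ≤ r := zero_le_one.trans hr.le
  unfold w₁ wB₁
  rw [norm_mul]
  have h1 := norm_cauchyWeight_le (norm_circ hr0 p.2) hr (interp_nonneg p.1) (interp_le_one p.1)
  have h2 : ‖Complex.I * circ r p.2‖ = r := by rw [norm_mul, Complex.norm_I, one_mul, norm_circ hr0]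
  rw [h2]
  exact mul_le_mul_of_nonneg_right h1 hr0

/-! ## §2 Finitely many contour variables: the product space -/

section Product

variable {J : Type*}

/-- THE CONTOUR VALUES `σ(j)(p) := circ (r j) (θ j)` (what is substituted for `σ(Δ)`, `τ(Y)` in the integrand of (2.14)). [folklore] -/
def sigmaJ (r : J → ℝ) (p : J → ℝ × ℝ) (j : J) : ℂ := circ (r j) (p j).2

/-- [folklore] The contour values live ON the circles: `‖sigmaJ r p j‖ = r j`. -/
theorem norm_sigmaJ {r : J → ℝ} (hr : ∀ j, 0 ≤ r j) (p : J → ℝ × ℝ) (j : J) : ‖sigmaJ r p j‖ = r j :=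
  norm_circ (hr j) _

/-- [folklore] …hence `‖sigmaJ r p j‖ ≤ r j` (the clause `‖τ p Y‖ ≤ rad Y` of a `BiCore`). -/
theorem norm_sigmaJ_le {r : J → ℝ} (hr : ∀ j, 0 ≤ r j) (p : J → ℝ × ℝ) (j : J) : ‖sigmaJ r p j‖ ≤ r j :=
  (norm_sigmaJ hr p j).le

/-- [folklore] Each contour value is measurable in the parameter. -/
theorem measurable_sigmaJ (r : J → ℝ) (j : J) : Measurable fun p : J → ℝ × ℝ => sigmaJ r p j :=
  (measurable_circ (r j)).comp (measurable_snd.comp (measurable_pi_apply j))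

/-- THE INTERPOLATION VALUES `s(j)(p) := interp (t j) ∈ [0, 1]`. [folklore] -/
def sJ (p : J → ℝ × ℝ) (j : J) : ℝ := interp (p j).1

/-- [folklore] `sJ p j ∈ [0, 1]`. -/
theorem sJ_mem_Icc (p : J → ℝ × ℝ) (j : J) : sJ p j ∈ Icc (0 : ℝ) 1 := ⟨interp_nonneg _, interp_le_one _⟩

/-- [folklore] Each interpolation value is measurable in the parameter. -/
theorem measurable_sJ (j : J) : Measurable fun p : J → ℝ × ℝ => sJ p j :=
  measurable_interp.comp (measurable_fst.comp (measurable_pi_apply j))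

variable (J) [Fintype J]

/-- THE PARAMETER MEASURE of finitely many contour variables: the product of `lam₁`'s over `J`. [folklore] -/
def lamJ : Measure (J → ℝ × ℝ) := Measure.pi fun _ => lam₁

/-- [folklore] It is finite. -/
instance isFiniteMeasure_lamJ : IsFiniteMeasure (lamJ J) := by
  unfold lamJ; infer_instance

variable {J}

/-- THE PRODUCT CAUCHY WEIGHT `Π_j w₁ (r j) (p j)` for radii `r : J → ℝ`. [folklore] -/
def wJ (r : J → ℝ) (p : J → ℝ × ℝ) : ℂ := ∏ j, w₁ (r j) (p j)

/-- [folklore] The product weight is measurable. -/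
theorem measurable_wJ (r : J → ℝ) : Measurable (wJ r) :=
  Finset.measurable_prod _ fun j _ => (measurable_w₁ (r j)).comp (measurable_pi_apply j)

/-- THE PRODUCT WEIGHT LETTER `w₀ := Π_j wB₁ (r j)`. [folklore] -/
def wBJ (r : J → ℝ) : ℝ := ∏ j, wB₁ (r j)

/-- [folklore] **`‖wJ r p‖ ≤ wBJ r` AT EVERY PARAMETER when every radius exceeds `1`** (the clause `∀ p, ‖w p‖ ≤ w₀` of the shape). -/
theorem norm_wJ_le {r : J → ℝ} (hr : ∀ j, 1 < r j) (p : J → ℝ × ℝ) : ‖wJ r p‖ ≤ wBJ r :=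
  norm_prod_le_prod_of_le _ fun j _ => norm_w₁_le (hr j) (p j)

/-- [folklore] `0 ≤ wBJ r` when every radius is nonnegative. -/
theorem wBJ_nonneg {r : J → ℝ} (hr : ∀ j, 0 ≤ r j) : 0 ≤ wBJ r :=
  Finset.prod_nonneg fun j _ => wB₁_nonneg (hr j)

/-- [folklore] The product weight, unfolded at the contour and interpolation values: `wJ r p = Π_j (2πi)⁻¹((σ j − s j)²)⁻¹(i σ j)`. -/
theorem wJ_eq (r : J → ℝ) (p : J → ℝ × ℝ) :
    wJ r p = ∏ j, (2 * Real.pi * Complex.I)⁻¹ * ((sigmaJ r p j - (sJ p j : ℂ)) ^ 2)⁻¹ * (Complex.I * sigmaJ r p j) := rfl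

end Product

/-! ## §3 The (2.14) index: cubes on the circle `e^{κ₁}`, polymers on their (2.18) circles -/

section Index

variable {Jc Jp : Type*}

/-- THE RADII OF (2.14): every cube `Δ ⊂ Z∖Z′₀` on the circle `|σ(Δ)| = e^{κ₁}` ((1.22) KIND), every polymer `Y ∈ 𝐃` on the circle of
its (2.18) radius `r Y` (letters of the instancer; values not asserted). [folklore] -/
def radii (κ₁ : ℝ) (r : Jp → ℝ) : Jc ⊕ Jp → ℝ := Sum.elim (fun _ => Real.exp κ₁) r

/-- [folklore] `radii` on a cube index. -/
@[simp] theorem radii_inl (κ₁ : ℝ) (r : Jp → ℝ) (Δ : Jc) : radii κ₁ r (Sum.inl Δ) = Real.exp κ₁ := rfl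

/-- [folklore] `radii` on a polymer index. -/
@[simp] theorem radii_inr (κ₁ : ℝ) (r : Jp → ℝ) (Y : Jp) : radii (Jc := Jc) κ₁ r (Sum.inr Y) = r Y := rfl

/-- [folklore] **THE PRINTED REGIME**: all radii exceed `1` as soon as `0 < κ₁` and every (2.18) radius exceeds `1` — then §2's weight
bound applies to the (2.14) parameter space `(Jc ⊕ Jp) → ℝ × ℝ`. -/
theorem one_lt_radii {κ₁ : ℝ} (hκ : 0 < κ₁) {r : Jp → ℝ} (hr : ∀ Y, 1 < r Y) : ∀ j : Jc ⊕ Jp, 1 < radii κ₁ r j := by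
  rintro (Δ | Y)
  · rw [radii_inl]
    exact lt_of_lt_of_le (by linarith) (Real.add_one_le_exp κ₁)
  · rw [radii_inr]; exact hr Y

/-- [folklore] …and are nonnegative under the same hypotheses. -/
theorem radii_nonneg {κ₁ : ℝ} (hκ : 0 < κ₁) {r : Jp → ℝ} (hr : ∀ Y, 1 < r Y) (j : Jc ⊕ Jp) : 0 ≤ radii κ₁ r j :=
  zero_le_one.trans (one_lt_radii hκ hr j).le

variable [Fintype Jc] [Fintype Jp]

/-- [folklore] **THE WEIGHT LETTER OF (2.14)**: on the parameter space of the cubes `Jc` and polymers `Jp`, at EVERY parameter,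
`‖wJ (radii κ₁ r) p‖ ≤ wBJ (radii κ₁ r) = (Π_{Δ} (2π)⁻¹((e^{κ₁} − 1)²)⁻¹e^{κ₁})·(Π_{Y} (2π)⁻¹((r Y − 1)²)⁻¹ r Y)`. -/
theorem norm_wJ_radii_le {κ₁ : ℝ} (hκ : 0 < κ₁) {r : Jp → ℝ} (hr : ∀ Y, 1 < r Y) (p : Jc ⊕ Jp → ℝ × ℝ) :
    ‖wJ (radii κ₁ r) p‖ ≤ wBJ (radii (Jc := Jc) κ₁ r) :=
  norm_wJ_le (one_lt_radii hκ hr) p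

/-- [folklore] The (2.14) weight letter as the product of the cube factor and the polymer factors. -/
theorem wBJ_radii (κ₁ : ℝ) (r : Jp → ℝ) :
    wBJ (radii (Jc := Jc) κ₁ r) = (∏ _Δ : Jc, wB₁ (Real.exp κ₁)) * ∏ Y : Jp, wB₁ (r Y) := by
  unfold wBJ
  rw [Fintype.prod_sum_type]
  rfl

end Index

/-! ## §4 The dictionary reproduces the printed contour: Cauchy's formula for the derivative -/

section Cauchy

/-- [folklore] `circ r θ` IS Mathlib's `circleMap 0 r θ`. -/
theorem circ_eq_circleMap (r θ : ℝ) : circ r θ = circleMap 0 r θ := by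
  rw [circleMap_zero, circ]

/-- **THE ONE-VARIABLE WEIGHT REPRODUCES `(2πi)⁻¹∮ dτ F(τ)∕(τ − t)² = F′(t)`** ([II] p. 15: the `σ(Δ)`- and `τ(Y)`-contours of
(2.14) are Cauchy representations of first derivatives in the interpolation parameters): for `F` holomorphic on an open set containing
the closed disc of radius `r > 1` and `t ∈ [0, 1]`, `∫_{θ∈[0,2π]} w₁ r (t, θ)·F(circ r θ) dθ = F′(t)` (Mathlib's
`two_pi_I_inv_smul_circleIntegral_sub_sq_inv_smul_of_differentiable` + `circleIntegral_def_Icc`; the clamp is the identity on `[0, 1]`).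
A CHECK of the dictionary (the `(2πi)⁻¹` and the `dτ∕dθ` factor of `w₁` are the right ones), not needed by the shape of record. [folklore] -/
theorem setIntegral_w₁_mul_eq_deriv {r : ℝ} (hr : 1 < r) {U : Set ℂ} (hU : IsOpen U) (hsub : Metric.closedBall (0 : ℂ) r ⊆ U)
    {F : ℂ → ℂ} (hF : DifferentiableOn ℂ F U) {t : ℝ} (ht0 : 0 ≤ t) (ht1 : t ≤ 1) :
    ∫ θ in Icc 0 (2 * Real.pi), w₁ r (t, θ) * F (circ r θ) = deriv F t := by
  have ht : (t : ℂ) ∈ Metric.ball (0 : ℂ) r := by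
    rw [Metric.mem_ball, dist_zero_right, Complex.norm_real, Real.norm_of_nonneg ht0]
    linarith
  rw [← Complex.two_pi_I_inv_smul_circleIntegral_sub_sq_inv_smul_of_differentiable hU hsub hF ht, circleIntegral_def_Icc,
    smul_eq_mul, ← integral_const_mul]
  refine setIntegral_congr_fun measurableSet_Icc fun θ _ => ?_
  simp only [w₁, interp_eq_self ht0 ht1, deriv_circleMap, smul_eq_mul, circ_eq_circleMap]
  ring

/-- **…AND THE `t`-INTEGRAL GIVES THE INTERPOLATED DIFFERENCE**: `∫ w₁ r p·F(circ r p.2) dlam₁(p) = F(1) − F(0)` — the one-variable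
parameter measure and weight of §1 encode EXACTLY `∫₀¹ dt (2πi)⁻¹∮_{|τ|=r} dτ F(τ)∕(τ − t)² = ∫₀¹ F′(t) dt = F(1) − F(0)`, the first-order
interpolation remainder in Cauchy form that (2.14) applies per cube `Δ` (in `s(Δ), σ(Δ)`) and per polymer `Y` (in `t(Y), τ(Y)`)
(Fubini on the finite product measure, §4's derivative formula, the fundamental theorem of calculus). [folklore] -/
theorem integral_w₁_mul_eq_sub {r : ℝ} (hr : 1 < r) {U : Set ℂ} (hU : IsOpen U) (hsub : Metric.closedBall (0 : ℂ) r ⊆ U)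
    {F : ℂ → ℂ} (hF : DifferentiableOn ℂ F U) : ∫ p, w₁ r p * F (circ r p.2) ∂lam₁ = F 1 - F 0 := by
  have hr0 : 0 ≤ r := zero_le_one.trans hr.le
  -- the integrand is bounded and measurable on a finite measure, hence integrable
  have hFc : ContinuousOn F (Metric.closedBall 0 r) := hF.continuousOn.mono hsub
  obtain ⟨M, hM⟩ := (isCompact_closedBall (0 : ℂ) r).exists_bound_of_continuousOn hFc
  have hcirc_mem : ∀ θ, circ r θ ∈ Metric.closedBall (0 : ℂ) r := fun θ => by
    rw [Metric.mem_closedBall, dist_zero_right, norm_circ hr0]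
  have hFθ : Continuous fun θ : ℝ => F (circ r θ) :=
    hFc.comp_continuous ((continuous_const.mul (Complex.continuous_exp.comp
      (Complex.continuous_ofReal.mul continuous_const))).congr fun θ => rfl) hcirc_mem
  have hmeas : AEStronglyMeasurable (fun p : ℝ × ℝ => w₁ r p * F (circ r p.2)) lam₁ :=
    ((measurable_w₁ r).mul (hFθ.measurable.comp measurable_snd)).aestronglyMeasurable
  have hint : Integrable (fun p : ℝ × ℝ => w₁ r p * F (circ r p.2)) lam₁ :=
    Integrable.mono' (integrable_const (wB₁ r * M)) hmeas (Filter.Eventually.of_forall fun p => by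
      rw [norm_mul]
      exact mul_le_mul (norm_w₁_le hr p) (hM _ (hcirc_mem p.2)) (norm_nonneg _) (wB₁_nonneg hr0))
  -- Fubini, then §4's formula in the inner integral
  rw [lam₁, integral_prod _ hint]
  have h1 : ∫ t in Icc (0 : ℝ) 1, (∫ θ in Icc (0 : ℝ) (2 * Real.pi), w₁ r (t, θ) * F (circ r θ)) =
      ∫ t in Icc (0 : ℝ) 1, deriv F t :=
    setIntegral_congr_fun measurableSet_Icc fun t ht => setIntegral_w₁_mul_eq_deriv hr hU hsub hF ht.1 ht.2
  rw [h1, integral_Icc_eq_integral_Ioc, ← intervalIntegral.integral_of_le zero_le_one]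
  -- the fundamental theorem of calculus along the real segment `[0, 1] ⊆ U`
  have hxU : ∀ x ∈ uIcc (0 : ℝ) 1, (x : ℂ) ∈ U := fun x hx => by
    rw [Set.uIcc_of_le zero_le_one] at hx
    refine hsub (Metric.mem_closedBall.2 ?_)
    rw [dist_zero_right, Complex.norm_real, Real.norm_of_nonneg hx.1]
    linarith [hx.2]
  have hderiv : ∀ x ∈ uIcc (0 : ℝ) 1, HasDerivAt (fun s : ℝ => F s) (deriv F x) x := fun x hx =>
    (hF.differentiableAt (hU.mem_nhds (hxU x hx))).hasDerivAt.comp_ofReal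
  have hcont : ContinuousOn (fun s : ℝ => deriv F s) (uIcc (0 : ℝ) 1) :=
    (hF.analyticOnNhd hU).deriv.continuousOn.comp Complex.continuous_ofReal.continuousOn hxU
  rw [intervalIntegral.integral_eq_sub_of_hasDerivAt hderiv (hcont.intervalIntegrable)]
  simp

end Cauchy

end Summit.QuantumFields.BalabanUV.T4Continuum.B13TermContours

end
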